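import Literature.MathematicalPhysics.QuantumFieldTheory.Balaban1983to89.B1Ineq233LowerBackgroundTorus

/-!
# `Balaban1983to89.B1Ineq233LowerBackgroundRegion` — T. Bałaban, *(Higgs)₂,₃ quantum fields in a finite volume. I. A lower bound*,
# Commun. Math. Phys. **85** (1982) 603–626 [Balaban1982Higgs1], PROPOSITION 2.3 (2.33) p. 611, LOWER HALF
# `γ₀I ≦ aL⁻²P(A) + Δ^{(k)}(Ω, A)` **AT A REGULAR BACKGROUND `A ≠ 0` FOR THE PRINTED REGIONS `Ω = B^k(Λ_k)`, `Λ_k ⊂ T^{(k)}` A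
# UNION OF BLOCKS, `1 ≦ k < K`**, on the concrete (Higgs)₂,₃ carrier — the region version of r14 g13's
# `B1Ineq233LowerBackgroundTorus` ([Balaban1983RegularityDecay] §5 (5.2)–(5.3): the covariant block Poincaré inequality keeping
# only the bonds INSIDE `Λ_k`, for fields supported in `Λ_k`, + p23's (II.3.29) at a regular field for regions
# `B2Ineq329RegularField.ineq329_regular_deltaKA`), instantiated at the background `A^{(k),ε}` of (3.29).

statement-level skeleton of published theorems with citation tags; proofs where landed; nothing here is a claim about the Yang–Mills mass gap

PDF held: `paper:balaban1982-cmp85-higgs23-i` (journal page = PDF page + 602): p. 611 [PDF 9] (Prop. 2.3 (2.33), «regular on Ω»),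
p. 610 [PDF 8] ((2.23), Prop. 2.1 «Ω a sum of big blocks»), pp. 606–607 ((1.17)–(1.18)); `paper:balaban1982-cmp86-higgs23-ii`
(journal = PDF + 554): pp. 588–590 [PDF 34–36] ((3.24) `ψ̃`, (3.28) `Ω = B^k(Λ_k)`, (3.29)); `paper:balaban1983-cmp89-regularity-decay`
(journal = PDF + 570): p. 574 [PDF 4] (Prop. 3.1′ «Let Ω be a sum of unit blocks»), p. 593 [PDF 23] (§5 (5.2)–(5.3)).

CITATION HEADER (lean-in-tree rule).  Cell `lit-balaban` (HOME `run/shared/lean/pub/lit-balaban/`), reader/typer seat **r14**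
gen 13 (unit `lit-balaban-r14`, B1 fold owner; TAKING line HOME/STATUS.md 2026-08-22T03:19:04Z, free-target protocol G.5-34(d)),
SKELETON row **B1.Prop2.3** (member (2.33) lower half; on this carrier at `A = 0` for regions: r14 g8
`B1Ineq233LowerZeroFieldRegion.ineq233_lower_zeroField_region`; at a regular `A ≠ 0` on the whole torus: r14 g13
`B1Ineq233LowerBackgroundTorus` p317716), input rows **B2.Prop3.1** ((3.29) regular field for regions, p23 g11 p312469) and
**B1.Prop2.1** ((2.23) of `A^{(k),ε}`, p35 g8 / p14 g10); referee ref-1.  USED BY NAME, never restated: r14 g13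
`B1Ineq233LowerBackgroundTorus.{norm_transport_bond_sub_le, siteInner_blockProjA_transport, abs_bgVec_shift_sub_le}` (p317716),
r14 g7 `B1Ineq233LowerZeroField.{block_poincare_vec, sum_ite_inside_block_le, mesh_succ}`, `B2Ineq329CovariantAveraging.sum_inside_tgt_le`,
`B2Restr216Lattice.norm_U_apply`, p23 g11 `B2Ineq329RegularField.{ineq329_regular_deltaKA, gamma0_regular_spec}`, p15
`B2Prop31ZeroFieldConcrete.{massK, massK_eq_siteInner, massK_nonneg, extL_apply_of_not}`, `B2Eq328DeltaK.extL`,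
`B2Eq328ConcretePieces.{LSite, pieceF}`, `B2Eq337ScalarIntegration.Regions`, `B2Eq255Concrete.barA`, r14/p35's
`B1Eq27StepAdjoint.avgQLin`, `B1Eq230FluctCov.{blockProjA, precOpA, deltaKA}`, `B1Eq230FluctCovPos.siteInner_blockProjA_eq`,
`B1Ineq233LowerZeroFieldTorus.bondInner_self_nonneg`, p35 g8 `B1Ineq225BackgroundTorus.norm_sderiv_bgVec_le` with p14 g10
`B1Ineq225DerivZeroFieldTorus.covDeriv_propagatorK_sup_bound`, `B1Eq31Concrete.bgVec`, `B1Eq211ZeroFieldTorus.Shape`.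

WHAT IS PRINTED (verbatim).  [B1] p. 611 [PDF 9]: *"Proposition 2.3. If a configuration A is regular on Ω in the sense defined in
Proposition 2.1, then there exist positive constants δ₀, c₀, γ₀, γ₁ dependent on d and a, and independent of A, k, Ω and Λ, such
that γ₀I ≦ aL^{−2}P(A) + Δ^{(k)}(Ω, A) ≦ γ₁I, (2.33)"*; p. 610 [PDF 8], Prop. 2.1: *"Let Ω ⊂ T_η be a sum of big blocks … and let a
configuration A be regular on Ω in the sense that |(∂^η_μA^η_ν)(x)| ≦ c e(L^kε)^{β−1}, x ∈ Ω (2.23)"*.  [B2] p. 590 [PDF 36]: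
*"⟨φ′_k, Δ^{(k)}(B^k(Λ_k), Ã^η)φ′_k⟩ ≧ γ₀(Σ_{⟨x,x′⟩⊂Λ_k}|U(Ã^η(⟨x,x′⟩))φ′_k(x′) − φ′_k(x)|² + Σ_{x∈Λ_k}m²(L^kε)²|φ′_k(x)|²) −
O((L^kε)^{κ₀})|Λ_k|, (3.29) with a constant γ₀ independent of k, Λ_k"*.  [B4] p. 593 [PDF 23]: *"To prove the lower bound we apply
Proposition II.3.1′ to Δ^{(k)}(Ω, A): … (5.2) … we separate the blocks by Neumann boundary conditions, in each block we decompose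
A = A₀ + A′ … Next we “gauge away” the constant field, and we obtain the Laplace operator with Neumann boundary conditions for
each block plus the projection operator on constant functions. This sum is bounded from below … (5.3) for e sufficiently small and
we get the lower bound."*; p. 574 [PDF 4]: *"Proposition 3.1′ of [2]. Let Ω be a sum of unit blocks (i.e. Ω^{(k)} is an arbitrary
subset of Z^d) and let A satisfies the condition |(∂^η_μA)(x)| ≦ O(1)p(e) (1.21) then … for e sufficiently small … (1.22)"*.

DICTIONARY (as in r14 g8's `B1Ineq233LowerZeroFieldRegion` and g13's torus file; NO rescaling to the unit lattice).  `Ω = B^k(Λ_k)`,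
`Λ_k = Ω^{(k)} ⊂ T^{(k)}` ↦ p15/p23's regions `R : Regions P K`, `Λ_k = R.block j` (`k = j+1`), `Ω = pieceF R j`; «Ω a sum of big
blocks» ↦ `Λ_k` a union of `(k+1)`-blocks (`hU`, weaker than big blocks, all the route needs); fields on `Λ_k` ↦ `ψ : LSite R j → ℝ^N`
with zero extension `ψ̃ = extL R j ψ` ((3.24)); `aL^{−2}P(A) + Δ^{(k)}(Ω, A)` ↦ `precOpA C (pieceF R j) A m² a k`; «A regular on Ω»
↦ `δ`-regular in lattice units ON ALL OF `T_ε` (a STRONGER hypothesis than print's, see HONEST SCOPE (ii); it is what the background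
`A^{(k),ε}` of (3.29) satisfies); the printed bond sum over `⟨x,x′⟩ ⊂ Λ_k` ↦ `Σ_{c ⊂ Λ_k}(L^kε)^d|(D_{Ā^{(k)}}ψ̃)(c)|²` (p23's form).

WHAT THIS FILE PROVES (kernel-checked, zero `sorry`, standard axioms; theorems only — no definition, no `Prop`-valued fact):
* §1 `sum_blocks_inside_le_inside_of` (generic form of r14 g8's lemma: in-block sums of a nonnegative bond function vanishing off `S`
  are bounded by the sum over the bonds inside `S`, `S` a union of blocks), **`siteInner_self_le_blockProjA_add_cov_inside`**: for `S` a
  union of `(k+1)`-blocks, `A` `δ`-regular, `ψ` vanishing off `S`: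
  `‖ψ‖² ≦ ⟨ψ, P(A)ψ⟩ + (L²/4)(L^kε)²Σ_{b⊂S}(L^kε)^d|(D_{Ā^{(k)}}ψ)(b)|² + (L²/4)dθ²‖ψ‖²` — the covariant block Poincaré inequality of
  the torus file with ONLY THE BONDS INSIDE `S` (those controlled by (3.29)).
* §2 **`ineq233_lower_regular_region`**: for `Λ_k` a union of blocks, `1 ≦ k = j+1 < K_P`, `L^kε ≦ 1`, `A` `δ`-regular on `T_ε` with
  the three smallness conditions of the torus file, and EVERY `ψ : Λ_k → ℝ^N`:
  `(c₁/2)(L^kε)^{−2}‖ψ̃‖² ≦ ⟨ψ̃, (a(L^{k+1}ε)^{−2}P(A) + Δ^{(k),L^kε}(B^k(Λ_k), A))ψ̃⟩`, `c₁ = min{a, 4γ₀}/L²` — one constant for all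
  `k`, all regions, all volumes.
* §3 **`ineq233_lower_bgVec_region`**: the same at the background `A^{(k),ε} = bgVec μ₀² a k A` of (3.29) (`|A| ≦ r`, `r·L^kε ≦ c_A`)
  with `∃ γ > 0, c_A > 0` depending on `(d, L, a, μ₀², m², e)` only — for EVERY region `Λ_k` (union of blocks) of every torus of the
  sub-family and every `1 ≦ k < K_P`.
* §4 (v1.1) **`siteInner_deltaKA_zero_region_cov`** ((2.17) at a general `A` for a region `Ω ⊂ T_ε`:
  `⟨ψ, Δ^{(0),ε}(Ω, A)ψ⟩ = Σ_{b⊂Ω}ε^d|(D_Aψ)(b)|² + m²‖ψ‖²`) and **`ineq233_lower_regular_region_levelZero`**: for `Ω ⊂ T_ε` a union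
  of blocks, `A` `δ`-regular with `L²dθ₀² ≦ 1` (`θ₀ = 2dL·ε|e|δ`), every `ψ` vanishing off `Ω`, every `ε`, `a, m² ≧ 0`:
  `(3c₁⁰/4)ε^{−2}‖ψ‖² ≦ ⟨ψ, (a(Lε)^{−2}P(A) + Δ^{(0),ε}(Ω, A))ψ⟩`, `c₁⁰ = min{a, 4}/L²`.
HONEST SCOPE.  (i) Regions `Ω = B^k(Λ_k)` with `Λ_k` a union of blocks (weaker than «big blocks»), `1 ≦ k < K_P` (§2–§3) and
`k = 0` (§4, v1.1).  (ii) REGULARITY IS ASSUMED ON ALL OF `T_ε` (print: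
«regular on Ω»): the staircase/holonomy toolkit of the torus file is global; for the background `A^{(k),ε}` this is satisfied
(p35's (2.23) holds on `T_ε`), for a general `A` regular only on `Ω` the theorem here is WEAKER than print.  (iii) Constants as in the
torus file (`½min{aL^{−2}, 4γ₀L^{−2}}` for the printed `½γ₀min{π²L^{−2}, aL^{−2}}`; `γ₀` p23's explicit constant; errors explicit).
(iv) (2.34)/(2.36) for regions at `A ≠ 0` would further need (2.27) at `A ≠ 0` for regions (p35's sup decay is torus-only at
present) — not claimed.  (v) Value = kernel certificate of the printed §5 mechanism for the printed regions at a regular background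
on the concrete carrier; NOT summit progress.  Unit `lit-balaban-r14-g13` (literature-prover-lit-balaban-r14-g13-0); HOME/FILED.md
records the proposal.
-/

noncomputable section

open scoped BigOperators InnerProductSpace
open Finset

namespace Literature.MathematicalPhysics.QuantumFieldTheory.Balaban1983to89.B1Ineq233LowerBackgroundRegion

open HiggsLattice HiggsAveraging HiggsCovariance HiggsCovariancePos B1Eq230FluctCov B1Eq230FluctCovPos
open B2Restr216Lattice (norm_U_apply)
open B2Ineq329CovariantAveraging (sum_inside_tgt_le)
open B2Eq255Concrete (barA)
open B1Eq27StepAdjoint (avgQLin)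
open B1Ineq233LowerZeroField (block_poincare_vec sum_ite_inside_block_le mesh_succ)
open HiggsFluctMeasurePos (siteInner_add_right siteInner_smul_right)
open B1Ineq233LowerBackgroundTorus (norm_transport_bond_sub_le siteInner_blockProjA_transport abs_bgVec_shift_sub_le)
open B2Eq337ScalarIntegration (Regions V)
open B2Eq328ConcretePieces (LSite pieceF)
open B2Eq328DeltaK (extL)
open B2Prop31ZeroFieldConcrete (massK massK_eq_siteInner massK_nonneg extL_apply_of_not)
open B2Ineq329RegularField (ineq329_regular_deltaKA gamma0_regular_spec)
open B1Ineq233LowerZeroFieldTorus (bondInner_self_nonneg)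

variable {P : HiggsLattice.Params} {N : ℕ}

/-! ## §1 The covariant block Poincaré inequality keeping only the bonds inside a union of blocks -/

section Inside

variable {k : ℕ}

/-- For `S ⊂ T^{(k)}` a union of blocks and a nonnegative bond function `G` vanishing on the bonds with both ends off `S`: the
in-block sums of `G` over ALL blocks are bounded by the sum over the bonds INSIDE `S` (a bond inside a block has both ends in `S`
or both ends off `S`). [cite: Balaban1982Higgs1, (1.17)–(1.18) p.606–607] -/
theorem sum_blocks_inside_le_inside_of (S : Finset (HiggsLattice.Site P k))
    (hS : ∀ x x' : HiggsLattice.Site P k, HiggsLattice.blockOf x = HiggsLattice.blockOf x' → (x ∈ S ↔ x' ∈ S))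
    (G : HiggsLattice.PBond P k → ℝ) (hG : ∀ b, 0 ≤ G b)
    (hG0 : ∀ b : HiggsLattice.PBond P k, b.src ∉ S → b.tgt ∉ S → G b = 0) :
    ∑ y : HiggsLattice.Site P (k + 1), ∑ b : HiggsLattice.PBond P k, (if Inside (HiggsLattice.block y) b then G b else 0)
      ≤ ∑ b : HiggsLattice.PBond P k, (if Inside S b then G b else 0) := by
  classical
  rw [Finset.sum_comm]
  refine Finset.sum_le_sum fun b _ => ?_
  by_cases hb : Inside S b
  · rw [if_pos hb]
    exact sum_ite_inside_block_le b (hG b)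
  · rw [if_neg hb]
    refine Finset.sum_nonpos fun y _ => ?_
    by_cases hy : Inside (HiggsLattice.block y) b
    · rw [if_pos hy]
      have hsrc : HiggsLattice.blockOf b.src = y := by
        have := hy.1
        simp only [HiggsLattice.block, Finset.mem_filter, Finset.mem_univ, true_and] at this
        exact this
      have htgt : HiggsLattice.blockOf b.tgt = y := by
        have := hy.2
        simp only [HiggsLattice.block, Finset.mem_filter, Finset.mem_univ, true_and] at this
        exact this
      have hiff : b.src ∈ S ↔ b.tgt ∈ S := hS b.src b.tgt (by rw [hsrc, htgt])
      have hs : b.src ∉ S := fun h => hb ⟨h, hiff.mp h⟩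
      have ht : b.tgt ∉ S := fun h => hs (hiff.mpr h)
      rw [hG0 b hs ht]
    · rw [if_neg hy]

variable (C : ChargeData N)

/-- **THE COVARIANT BLOCK POINCARÉ INEQUALITY WITH ONLY THE BONDS INSIDE A UNION OF BLOCKS** (`k < K`, at least two `(k+1)`-sites
per direction, `A` `δ`-regular on `T_ε`, `S ⊂ T^{(k)}` a union of `(k+1)`-blocks, `ψ` vanishing off `S`):
`‖ψ‖² ≦ ⟨ψ, P(A)ψ⟩ + (L²/4)(L^kε)²·Σ_{b⊂S}(L^kε)^d|(D_{Ā^{(k)}}ψ)(b)|² + (L²/4)dθ²‖ψ‖²`, `θ = 2dL·L^{2k}ε|e|δ` — the torus file's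
`siteInner_self_le_blockProjA_add_cov` with r14 g8's support bookkeeping: an in-block bond off `S` carries `D_{Ā^{(k)}}ψ = 0`.
[cite: Balaban1983RegularityDecay, §5 (5.2)–(5.3) p.593, (2.27) p.580] [cite: Balaban1982Higgs1, Prop. 2.3 (2.33) p.611] -/
theorem siteInner_self_le_blockProjA_add_cov_inside (hk : k < P.K) (hN2 : ∀ μ, 2 ≤ P.sitesPerDir (k + 1) μ)
    (S : Finset (HiggsLattice.Site P k))
    (hS : ∀ x x' : HiggsLattice.Site P k, HiggsLattice.blockOf x = HiggsLattice.blockOf x' → (x ∈ S ↔ x' ∈ S))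
    (A : HiggsLattice.VecField P 0) {δ : ℝ} (hδ : 0 ≤ δ)
    (hreg : ∀ (z : HiggsLattice.Site P 0) (μ' ν : Fin P.d), |A ⟨z.shift ν, μ'⟩ - A ⟨z, μ'⟩| ≤ δ)
    (ψ : ScalarField P k N) (hψ : ∀ x, x ∉ S → ψ x = 0) :
    siteInner ψ ψ ≤ siteInner ψ (blockProjA C A k ψ)
      + (P.L : ℝ) ^ 2 / 4 * P.mesh k ^ 2 *
          (∑ b : HiggsLattice.PBond P k, if Inside S b then P.mesh k ^ P.d * ‖covDeriv C (barA k A) ψ b‖ ^ 2 else 0)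
      + (P.L : ℝ) ^ 2 / 4 * P.d * (2 * P.d * P.L * ((P.L : ℝ) ^ k) ^ 2 * (P.mesh 0 * |C.e|) * δ) ^ 2 * siteInner ψ ψ := by
  classical
  obtain ⟨θ, hθ⟩ : ∃ θ : ℝ, θ = 2 * P.d * P.L * ((P.L : ℝ) ^ k) ^ 2 * (P.mesh 0 * |C.e|) * δ := ⟨_, rfl⟩
  rw [← hθ]
  obtain ⟨ψ', hψ'⟩ : ∃ ψ' : ScalarField P k N,
      ψ' = fun x => C.U (P.mesh 0) (contourSum A (toFinest (HiggsLattice.blockOf x)) (toFinest x)) (ψ x) := ⟨_, rfl⟩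
  have hm : 0 < P.mesh k := P.mesh_pos k
  have hmd : 0 < P.mesh k ^ P.d := pow_pos hm _
  have hnorm : ∀ x, ‖ψ' x‖ = ‖ψ x‖ := fun x => by rw [hψ']; exact norm_U_apply C _ _ _
  -- per in-block bond: `‖ψ′(b₊) − ψ′(b₋)‖² ≤ 2(Lᵏε)²‖(Dψ)(b)‖² + 2θ²‖ψ(b₊)‖²`
  have hbond : ∀ b : HiggsLattice.PBond P k, HiggsLattice.blockOf b.tgt = HiggsLattice.blockOf b.src →
      ‖ψ' b.tgt - ψ' b.src‖ ^ 2
        ≤ 2 * (P.mesh k ^ 2 * ‖covDeriv C (barA k A) ψ b‖ ^ 2) + 2 * (θ ^ 2 * ‖ψ b.tgt‖ ^ 2) := by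
    intro b hb
    have h := norm_transport_bond_sub_le C hk hN2 hδ hreg ψ b hb
    rw [← hθ] at h
    have h' : ‖ψ' b.tgt - ψ' b.src‖ ≤ P.mesh k * ‖covDeriv C (barA k A) ψ b‖ + θ * ‖ψ b.tgt‖ := by
      rw [hψ']; exact h
    have h0 : 0 ≤ ‖ψ' b.tgt - ψ' b.src‖ := norm_nonneg _
    have hsq : ‖ψ' b.tgt - ψ' b.src‖ ^ 2
        ≤ 2 * (P.mesh k * ‖covDeriv C (barA k A) ψ b‖) ^ 2 + 2 * (θ * ‖ψ b.tgt‖) ^ 2 := by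
      nlinarith [mul_nonneg h0 (sub_nonneg.mpr h'), mul_nonneg (h0.trans h') (sub_nonneg.mpr h'),
        sq_nonneg (P.mesh k * ‖covDeriv C (barA k A) ψ b‖ - θ * ‖ψ b.tgt‖)]
    rw [mul_pow, mul_pow] at hsq
    exact hsq
  -- an in-block bond with both ends off `S` carries `(Dψ)(b) = 0`
  have hD0 : ∀ b : HiggsLattice.PBond P k, b.src ∉ S → b.tgt ∉ S →
      2 * (P.mesh k ^ 2 * ‖covDeriv C (barA k A) ψ b‖ ^ 2) = 0 := by
    intro b hs ht
    rw [covDeriv, hψ _ hs, hψ _ ht, map_zero, sub_zero, smul_zero, norm_zero]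
    ring
  -- (1) `‖ψ‖²` block by block
  have h1 : siteInner ψ ψ = P.mesh k ^ P.d * ∑ y : HiggsLattice.Site P (k + 1), ∑ x ∈ HiggsLattice.block y, ‖ψ x‖ ^ 2 := by
    rw [siteInner, ← Finset.mul_sum]
    congr 1
    simp_rw [real_inner_self_eq_norm_sq]
    exact (Finset.sum_fiberwise_of_maps_to (s := Finset.univ) (t := Finset.univ)
      (g := fun x : HiggsLattice.Site P k => HiggsLattice.blockOf x) (fun _ _ => Finset.mem_univ _) _).symm
  -- (2) `⟨ψ, P(A)ψ⟩`
  have h2 : siteInner ψ (blockProjA C A k ψ) = P.mesh k ^ P.d * (((P.L : ℝ) ^ P.d)⁻¹ *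
      ∑ y : HiggsLattice.Site P (k + 1), ‖∑ x ∈ HiggsLattice.block y, ψ' x‖ ^ 2) := by
    rw [hψ']; exact siteInner_blockProjA_transport C A ψ
  -- (3) the inside bond form
  have h3 : (∑ b : HiggsLattice.PBond P k, if Inside S b then P.mesh k ^ P.d * ‖covDeriv C (barA k A) ψ b‖ ^ 2 else 0)
      = P.mesh k ^ P.d * ∑ b : HiggsLattice.PBond P k, (if Inside S b then ‖covDeriv C (barA k A) ψ b‖ ^ 2 else 0) := by
    rw [Finset.mul_sum]
    refine Finset.sum_congr rfl fun b _ => ?_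
    split_ifs <;> simp
  -- (4) the in-block bond sums
  have h4 : ∑ y : HiggsLattice.Site P (k + 1), ∑ b : HiggsLattice.PBond P k,
      (if Inside (HiggsLattice.block y) b then ‖ψ' b.tgt - ψ' b.src‖ ^ 2 else 0)
      ≤ (∑ b : HiggsLattice.PBond P k, (if Inside S b then 2 * (P.mesh k ^ 2 * ‖covDeriv C (barA k A) ψ b‖ ^ 2) else 0))
        + ∑ y : HiggsLattice.Site P (k + 1), ((P.d : ℝ) * ∑ x ∈ HiggsLattice.block y, 2 * (θ ^ 2 * ‖ψ x‖ ^ 2)) := by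
    have hα : ∀ y : HiggsLattice.Site P (k + 1), ∑ b : HiggsLattice.PBond P k,
        (if Inside (HiggsLattice.block y) b then ‖ψ' b.tgt - ψ' b.src‖ ^ 2 else 0)
        ≤ (∑ b : HiggsLattice.PBond P k,
            (if Inside (HiggsLattice.block y) b then 2 * (P.mesh k ^ 2 * ‖covDeriv C (barA k A) ψ b‖ ^ 2) else 0))
          + ∑ b : HiggsLattice.PBond P k,
            (if Inside (HiggsLattice.block y) b then 2 * (θ ^ 2 * ‖ψ b.tgt‖ ^ 2) else 0) := by
      intro y
      rw [← Finset.sum_add_distrib]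
      refine Finset.sum_le_sum fun b _ => ?_
      split_ifs with hin
      · have hs := hin.1
        have ht := hin.2
        simp only [HiggsLattice.block, Finset.mem_filter, Finset.mem_univ, true_and] at hs ht
        exact hbond b (by rw [hs, ht])
      · simp
    have hβ : ∀ y : HiggsLattice.Site P (k + 1), ∑ b : HiggsLattice.PBond P k,
        (if Inside (HiggsLattice.block y) b then 2 * (θ ^ 2 * ‖ψ b.tgt‖ ^ 2) else 0)
        ≤ (P.d : ℝ) * ∑ x ∈ HiggsLattice.block y, 2 * (θ ^ 2 * ‖ψ x‖ ^ 2) := fun y =>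
      sum_inside_tgt_le (HiggsLattice.block y) (fun x => 2 * (θ ^ 2 * ‖ψ x‖ ^ 2)) fun x => by positivity
    have hγ : ∑ y : HiggsLattice.Site P (k + 1), ∑ b : HiggsLattice.PBond P k,
        (if Inside (HiggsLattice.block y) b then 2 * (P.mesh k ^ 2 * ‖covDeriv C (barA k A) ψ b‖ ^ 2) else 0)
        ≤ ∑ b : HiggsLattice.PBond P k, (if Inside S b then 2 * (P.mesh k ^ 2 * ‖covDeriv C (barA k A) ψ b‖ ^ 2) else 0) :=
      sum_blocks_inside_le_inside_of S hS (fun b => 2 * (P.mesh k ^ 2 * ‖covDeriv C (barA k A) ψ b‖ ^ 2))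
        (fun b => by positivity) hD0
    calc ∑ y : HiggsLattice.Site P (k + 1), ∑ b : HiggsLattice.PBond P k,
          (if Inside (HiggsLattice.block y) b then ‖ψ' b.tgt - ψ' b.src‖ ^ 2 else 0)
        ≤ ∑ y : HiggsLattice.Site P (k + 1), ((∑ b : HiggsLattice.PBond P k,
            (if Inside (HiggsLattice.block y) b then 2 * (P.mesh k ^ 2 * ‖covDeriv C (barA k A) ψ b‖ ^ 2) else 0))
          + (P.d : ℝ) * ∑ x ∈ HiggsLattice.block y, 2 * (θ ^ 2 * ‖ψ x‖ ^ 2)) :=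
          Finset.sum_le_sum fun y _ => (hα y).trans (add_le_add le_rfl (hβ y))
      _ = (∑ y : HiggsLattice.Site P (k + 1), ∑ b : HiggsLattice.PBond P k,
            (if Inside (HiggsLattice.block y) b then 2 * (P.mesh k ^ 2 * ‖covDeriv C (barA k A) ψ b‖ ^ 2) else 0))
          + ∑ y : HiggsLattice.Site P (k + 1), ((P.d : ℝ) * ∑ x ∈ HiggsLattice.block y, 2 * (θ ^ 2 * ‖ψ x‖ ^ 2)) :=
          Finset.sum_add_distrib
      _ ≤ _ := add_le_add hγ le_rfl
  -- constants out of the two sums of (4)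
  have hSB : (∑ b : HiggsLattice.PBond P k, (if Inside S b then 2 * (P.mesh k ^ 2 * ‖covDeriv C (barA k A) ψ b‖ ^ 2) else 0))
      = 2 * P.mesh k ^ 2 * ∑ b : HiggsLattice.PBond P k, (if Inside S b then ‖covDeriv C (barA k A) ψ b‖ ^ 2 else 0) := by
    rw [Finset.mul_sum]
    refine Finset.sum_congr rfl fun b _ => ?_
    split_ifs <;> ring
  have hS1 : ∑ y : HiggsLattice.Site P (k + 1), ((P.d : ℝ) * ∑ x ∈ HiggsLattice.block y, 2 * (θ ^ 2 * ‖ψ x‖ ^ 2))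
      = 2 * θ ^ 2 * (P.d : ℝ) * ∑ y : HiggsLattice.Site P (k + 1), ∑ x ∈ HiggsLattice.block y, ‖ψ x‖ ^ 2 := by
    rw [Finset.mul_sum]
    refine Finset.sum_congr rfl fun y _ => ?_
    rw [Finset.mul_sum, Finset.mul_sum]
    exact Finset.sum_congr rfl fun x _ => by ring
  rw [hSB, hS1] at h4
  -- (5) the block Poincaré inequality for `ψ′`, block by block, summed
  have hblk : ∀ y : HiggsLattice.Site P (k + 1),
      ∑ x ∈ HiggsLattice.block y, ‖ψ x‖ ^ 2 - ((P.L : ℝ) ^ P.d)⁻¹ * ‖∑ x ∈ HiggsLattice.block y, ψ' x‖ ^ 2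
        ≤ (P.L : ℝ) ^ 2 / 8 *
          ∑ b : HiggsLattice.PBond P k, if Inside (HiggsLattice.block y) b then ‖ψ' b.tgt - ψ' b.src‖ ^ 2 else 0 := by
    intro y
    have h := block_poincare_vec hk y ψ'
    simp_rw [hnorm] at h
    exact h
  have hblocks := Finset.sum_le_sum fun y (_ : y ∈ (Finset.univ : Finset (HiggsLattice.Site P (k + 1)))) => hblk y
  rw [Finset.sum_sub_distrib, ← Finset.mul_sum, ← Finset.mul_sum] at hblocks
  -- assemble
  have hL8 : 0 ≤ (P.L : ℝ) ^ 2 / 8 := by positivity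
  have h4' := mul_le_mul_of_nonneg_left h4 hL8
  have key : ∑ y : HiggsLattice.Site P (k + 1), ∑ x ∈ HiggsLattice.block y, ‖ψ x‖ ^ 2
      ≤ ((P.L : ℝ) ^ P.d)⁻¹ * ∑ y : HiggsLattice.Site P (k + 1), ‖∑ x ∈ HiggsLattice.block y, ψ' x‖ ^ 2
        + (P.L : ℝ) ^ 2 / 8 * (2 * P.mesh k ^ 2 *
            ∑ b : HiggsLattice.PBond P k, (if Inside S b then ‖covDeriv C (barA k A) ψ b‖ ^ 2 else 0)
          + 2 * θ ^ 2 * (P.d : ℝ) * ∑ y : HiggsLattice.Site P (k + 1), ∑ x ∈ HiggsLattice.block y, ‖ψ x‖ ^ 2) := by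
    linarith
  have eI : (P.L : ℝ) ^ 2 / 4 * P.d * θ ^ 2 * siteInner ψ ψ = (P.L : ℝ) ^ 2 / 4 * P.d * θ ^ 2
      * (P.mesh k ^ P.d * ∑ y : HiggsLattice.Site P (k + 1), ∑ x ∈ HiggsLattice.block y, ‖ψ x‖ ^ 2) := by rw [h1]
  rw [h3, eI, h2, h1]
  calc P.mesh k ^ P.d * ∑ y : HiggsLattice.Site P (k + 1), ∑ x ∈ HiggsLattice.block y, ‖ψ x‖ ^ 2
      ≤ P.mesh k ^ P.d * (((P.L : ℝ) ^ P.d)⁻¹ * ∑ y : HiggsLattice.Site P (k + 1), ‖∑ x ∈ HiggsLattice.block y, ψ' x‖ ^ 2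
        + (P.L : ℝ) ^ 2 / 8 * (2 * P.mesh k ^ 2 *
            ∑ b : HiggsLattice.PBond P k, (if Inside S b then ‖covDeriv C (barA k A) ψ b‖ ^ 2 else 0)
          + 2 * θ ^ 2 * (P.d : ℝ) * ∑ y : HiggsLattice.Site P (k + 1), ∑ x ∈ HiggsLattice.block y, ‖ψ x‖ ^ 2)) :=
        mul_le_mul_of_nonneg_left key hmd.le
    _ = _ := by ring

end Inside

/-! ## §2 (2.33) LOWER HALF at a regular background for the printed regions `Ω = B^k(Λ_k)`, `1 ≤ k < K` -/

section Region

variable {K : ℕ} (R : Regions P K) (C : ChargeData N) {a msq : ℝ}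

/-- **(2.33) LOWER HALF AT A REGULAR BACKGROUND `Ã ≠ 0` FOR THE PRINTED REGIONS** (`Ω = B^k(Λ_k)`, `Λ_k = R.block j ⊂ T^{(k)}` a
union of blocks, `1 ≦ k = j+1 < K_P`, `L^kε ≦ 1`, `m² > 0`, `a > 0`, `L > 1`, at least two `(k+1)`-sites per direction, `Ã` `δ`-regular
on `T_ε` with the three smallness conditions of the torus file, `γ₀` p23's (3.29)-constant): for EVERY `ψ : Λ_k → ℝ^N`,
`(c₁/2)(L^kε)^{−2}‖ψ̃‖² ≦ ⟨ψ̃, (a(L^{k+1}ε)^{−2}P(Ã) + Δ^{(k),L^kε}(B^k(Λ_k), Ã))ψ̃⟩`, `c₁ = min{a, 4γ₀}/L²`, `ψ̃` the zero extension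
(3.24) — §1's support-respecting covariant block Poincaré inequality + p23's (II.3.29) at the regular field for regions
(`ineq329_regular_deltaKA`, mass term dropped), the two error terms absorbed as in the torus file.
[cite: Balaban1982Higgs1, Prop. 2.3 (2.33) p.611] [cite: Balaban1982Higgs2, (3.29) p.590]
[cite: Balaban1983RegularityDecay, §5 (5.2)–(5.3) p.593, (1.21)–(1.22) p.574] -/
theorem ineq233_lower_regular_region (ha : 0 < a) (hL : 1 < P.L) (hmsq : 0 < msq) (hK : K ≤ P.K) (j : Fin K)
    (hjK : j.val + 1 < P.K) (hN2 : ∀ μ, 2 ≤ P.sitesPerDir (j.val + 1 + 1) μ) (hs : P.mesh (j.val + 1) ≤ 1)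
    (hU : ∀ y y' : HiggsLattice.Site P (j.val + 1),
      HiggsLattice.blockOf y = HiggsLattice.blockOf y' → (y ∈ R.block j ↔ y' ∈ R.block j))
    (A : HiggsLattice.VecField P 0) {δ : ℝ} (hδ : 0 ≤ δ)
    (hreg : ∀ (z : HiggsLattice.Site P 0) (μ' ν : Fin P.d), |A ⟨z.shift ν, μ'⟩ - A ⟨z, μ'⟩| ≤ δ)
    (hsmall : 8 * (P.d : ℝ) ^ 4 * (P.L : ℝ) ^ P.d * C.e ^ 2 * P.mesh (j.val + 1) ^ 2 *
      ((P.L : ℝ) ^ (j.val + 1)) ^ 2 * δ ^ 2 ≤ 1 / 2)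
    {γ₀ : ℝ} (hγ0 : 0 ≤ γ₀) (hγB : γ₀ * (8 * P.d + 2 * msq + 4) ≤ a * (1 - ((P.L : ℝ) ^ 2)⁻¹))
    (hγ16 : γ₀ ≤ 1 / 16)
    (hE : 64 * γ₀ * (P.d : ℝ) ^ 3 * C.e ^ 2 * ((P.L : ℝ) ^ (j.val + 1)) ^ 2 * δ ^ 2 * P.mesh (j.val + 1) ^ 2
      ≤ min a (4 * γ₀) / (P.L : ℝ) ^ 2 / 4)
    (hθ : (P.L : ℝ) ^ 2 * P.d *
      (2 * P.d * P.L * ((P.L : ℝ) ^ (j.val + 1)) ^ 2 * (P.mesh 0 * |C.e|) * δ) ^ 2 ≤ 1)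
    (ψ : LSite R j → V N) :
    min a (4 * γ₀) / (P.L : ℝ) ^ 2 / 2 * ((P.mesh (j.val + 1))⁻¹ ^ 2) * siteInner (extL R j ψ) (extL R j ψ)
      ≤ siteInner (extL R j ψ) (precOpA C (pieceF R j) A msq a (j.val + 1) (extL R j ψ)) := by
  have hL1 : (1 : ℝ) < (P.L : ℝ) := by exact_mod_cast hL
  have hL0 : (0 : ℝ) < (P.L : ℝ) := by linarith
  have hm : 0 < P.mesh (j.val + 1) := P.mesh_pos _
  obtain ⟨S, hSdef⟩ : ∃ S, S = siteInner (extL R j ψ) (extL R j ψ) := ⟨_, rfl⟩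
  obtain ⟨X, hX⟩ : ∃ X, X = siteInner (extL R j ψ) (blockProjA C A (j.val + 1) (extL R j ψ)) := ⟨_, rfl⟩
  obtain ⟨B, hB⟩ : ∃ B, B = ∑ c : HiggsLattice.PBond P (j.val + 1), (if Inside (R.block j) c then
      P.mesh (j.val + 1) ^ P.d * ‖covDeriv C (barA (j.val + 1) A) (extL R j ψ) c‖ ^ 2 else 0) := ⟨_, rfl⟩
  obtain ⟨D, hD⟩ : ∃ D, D = siteInner (extL R j ψ) (deltaKA C (pieceF R j) A msq a (j.val + 1) (extL R j ψ)) := ⟨_, rfl⟩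
  obtain ⟨θ, hθdef⟩ : ∃ θ : ℝ, θ = 2 * P.d * P.L * ((P.L : ℝ) ^ (j.val + 1)) ^ 2 * (P.mesh 0 * |C.e|) * δ := ⟨_, rfl⟩
  obtain ⟨E, hEdef⟩ : ∃ E : ℝ, E = 64 * γ₀ * (P.d : ℝ) ^ 3 * C.e ^ 2 * ((P.L : ℝ) ^ (j.val + 1)) ^ 2 * δ ^ 2 := ⟨_, rfl⟩
  obtain ⟨c₁, hc₁⟩ : ∃ c₁ : ℝ, c₁ = min a (4 * γ₀) / (P.L : ℝ) ^ 2 := ⟨_, rfl⟩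
  rw [← hθdef] at hθ
  rw [← hEdef, ← hc₁] at hE
  have hS0 : 0 ≤ S := hSdef ▸ siteInner_self_nonneg _
  have hX0 : 0 ≤ X := by rw [hX, siteInner_blockProjA_eq]; exact siteInner_self_nonneg _
  have hB0 : 0 ≤ B := by
    rw [hB]
    exact Finset.sum_nonneg fun c _ => by split_ifs <;> positivity
  have hmi0 : 0 < (P.mesh (j.val + 1))⁻¹ ^ 2 := by positivity
  -- §1 for `ψ̃`, `S = Λ_k`
  have hsupp : ∀ y, y ∉ R.block j → extL R j ψ y = 0 := fun y hy => extL_apply_of_not R j ψ hy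
  have hCP : S ≤ X + (P.L : ℝ) ^ 2 / 4 * P.mesh (j.val + 1) ^ 2 * B + (P.L : ℝ) ^ 2 / 4 * P.d * θ ^ 2 * S := by
    rw [hSdef, hX, hB, hθdef]
    exact siteInner_self_le_blockProjA_add_cov_inside C hjK hN2 (R.block j) hU A hδ hreg (extL R j ψ) hsupp
  -- (II.3.29) at the regular field for the region (p23), mass term dropped
  have hΔ : γ₀ * B - E * S ≤ D := by
    have h := ineq329_regular_deltaKA R C hK ha hL hmsq A j hs hδ (fun z _ μ' ν => hreg z μ' ν) hsmall hγ0 hγB hγ16 ψ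
    have hmass : 0 ≤ massK R msq j ψ := massK_nonneg R hmsq.le j ψ
    have e5 : (∑ y : LSite R j, P.mesh (j.val + 1) ^ P.d * ‖ψ y‖ ^ 2) = S := by
      have h1 := massK_eq_siteInner R 1 j ψ
      rw [one_mul, massK] at h1
      rw [hSdef, ← h1]
      exact Finset.sum_congr rfl fun y _ => by rw [mul_one]
    rw [e5, ← hB, ← hEdef, ← hD] at h
    nlinarith [mul_nonneg hγ0 hmass]
  -- the form of `a(L^{k+1}ε)^{-2}P(Ã) + Δ^{(k)}(Ω, Ã)`
  have hprec : siteInner (extL R j ψ) (precOpA C (pieceF R j) A msq a (j.val + 1) (extL R j ψ))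
      = a * ((P.mesh (j.val + 1 + 1))⁻¹ ^ 2) * X + D := by
    rw [precOpA, LinearMap.add_apply, LinearMap.smul_apply, siteInner_add_right, siteInner_smul_right, hX, hD]
  have hinv : ((P.L : ℝ) * P.mesh (j.val + 1))⁻¹ ^ 2 = ((P.L : ℝ) ^ 2)⁻¹ * (P.mesh (j.val + 1))⁻¹ ^ 2 := by
    rw [mul_inv, mul_pow, inv_pow]
  rw [hprec, ← hSdef, ← hc₁, mesh_succ (j.val + 1), hinv]
  -- the constants
  have hc₁0 : 0 ≤ c₁ := by rw [hc₁]; exact div_nonneg (le_min ha.le (by linarith)) (by positivity)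
  have hc₁a : c₁ ≤ a * ((P.L : ℝ) ^ 2)⁻¹ := by
    rw [hc₁, div_eq_mul_inv]
    exact mul_le_mul_of_nonneg_right (min_le_left _ _) (inv_nonneg.mpr (by positivity))
  have hc₁γ : c₁ * ((P.L : ℝ) ^ 2 / 4) ≤ γ₀ := by
    have hL2 : (0 : ℝ) < (P.L : ℝ) ^ 2 := by positivity
    have e : min a (4 * γ₀) / (P.L : ℝ) ^ 2 * ((P.L : ℝ) ^ 2 / 4) = min a (4 * γ₀) / 4 := by
      rw [div_mul_div_comm, mul_comm (min a (4 * γ₀)), mul_div_mul_left _ _ hL2.ne']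
    rw [hc₁, e]
    linarith [min_le_right a (4 * γ₀)]
  -- the pieces, multiplied out
  have hmm : (P.mesh (j.val + 1))⁻¹ ^ 2 * P.mesh (j.val + 1) ^ 2 = 1 := by field_simp
  have F1 : c₁ * (P.mesh (j.val + 1))⁻¹ ^ 2 * S ≤ c₁ * (P.mesh (j.val + 1))⁻¹ ^ 2 * X + c₁ * ((P.L : ℝ) ^ 2 / 4) * B
      + c₁ * (P.mesh (j.val + 1))⁻¹ ^ 2 * ((P.L : ℝ) ^ 2 / 4 * P.d * θ ^ 2 * S) := by
    have h := mul_le_mul_of_nonneg_left hCP (mul_nonneg hc₁0 hmi0.le)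
    have e : c₁ * (P.mesh (j.val + 1))⁻¹ ^ 2 * (X + (P.L : ℝ) ^ 2 / 4 * P.mesh (j.val + 1) ^ 2 * B
        + (P.L : ℝ) ^ 2 / 4 * P.d * θ ^ 2 * S)
        = c₁ * (P.mesh (j.val + 1))⁻¹ ^ 2 * X
          + c₁ * ((P.L : ℝ) ^ 2 / 4) * ((P.mesh (j.val + 1))⁻¹ ^ 2 * P.mesh (j.val + 1) ^ 2) * B
          + c₁ * (P.mesh (j.val + 1))⁻¹ ^ 2 * ((P.L : ℝ) ^ 2 / 4 * P.d * θ ^ 2 * S) := by ring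
    rw [hmm, mul_one] at e
    linarith
  have F2 : c₁ * ((P.mesh (j.val + 1))⁻¹ ^ 2 * X) ≤ a * ((P.L : ℝ) ^ 2)⁻¹ * ((P.mesh (j.val + 1))⁻¹ ^ 2 * X) :=
    mul_le_mul_of_nonneg_right hc₁a (mul_nonneg hmi0.le hX0)
  have F3 : c₁ * ((P.L : ℝ) ^ 2 / 4) * B ≤ γ₀ * B := mul_le_mul_of_nonneg_right hc₁γ hB0
  have F6 : E * S + c₁ * (P.mesh (j.val + 1))⁻¹ ^ 2 * ((P.L : ℝ) ^ 2 / 4 * P.d * θ ^ 2 * S)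
      ≤ c₁ / 2 * (P.mesh (j.val + 1))⁻¹ ^ 2 * S := by
    have h1 : E ≤ c₁ / 4 * (P.mesh (j.val + 1))⁻¹ ^ 2 := by
      have e : E * P.mesh (j.val + 1) ^ 2 * (P.mesh (j.val + 1))⁻¹ ^ 2 = E := by field_simp
      calc E = E * P.mesh (j.val + 1) ^ 2 * (P.mesh (j.val + 1))⁻¹ ^ 2 := e.symm
        _ ≤ c₁ / 4 * (P.mesh (j.val + 1))⁻¹ ^ 2 := mul_le_mul_of_nonneg_right hE hmi0.le
    have h2 : (P.L : ℝ) ^ 2 / 4 * P.d * θ ^ 2 ≤ 1 / 4 := by linarith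
    have h3 : c₁ * (P.mesh (j.val + 1))⁻¹ ^ 2 * ((P.L : ℝ) ^ 2 / 4 * P.d * θ ^ 2 * S)
        ≤ c₁ * (P.mesh (j.val + 1))⁻¹ ^ 2 * (1 / 4 * S) :=
      mul_le_mul_of_nonneg_left (mul_le_mul_of_nonneg_right h2 hS0) (mul_nonneg hc₁0 hmi0.le)
    have h4 : E * S ≤ c₁ / 4 * (P.mesh (j.val + 1))⁻¹ ^ 2 * S := mul_le_mul_of_nonneg_right h1 hS0
    linarith
  linarith

end Region

/-! ## §3 (2.33) LOWER HALF at the background `A^{(k),ε}` of (3.29) for the printed regions -/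

section Background

open B3MultiscaleFields (toSite zeroCharge)
open B1Eq31Concrete (bgVec)
open B1Eq211ZeroFieldTorus (Shape)
open B1Ineq225DerivZeroFieldTorus (covDeriv_propagatorK_sup_bound)

/-- Absorption arithmetic in threshold form: `0 ≤ X`, `0 ≤ t ≤ 1`, `0 ≤ κ`, `t ≤ c/(κX + 1)` give `κXt² ≤ c`. [folklore] -/
private theorem mul_sq_le_of_le_div {X t c κ : ℝ} (hX : 0 ≤ X) (ht0 : 0 ≤ t) (ht1 : t ≤ 1) (hκ : 0 ≤ κ)
    (h : t ≤ c / (κ * X + 1)) : κ * X * t ^ 2 ≤ c := by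
  have h' : t * (κ * X + 1) ≤ c := by rwa [le_div_iff₀ (by positivity)] at h
  have htt : t ^ 2 ≤ t := by nlinarith
  nlinarith [mul_nonneg (mul_nonneg hκ hX) (sub_nonneg.mpr htt)]

/-- **(2.33) LOWER HALF AT THE REGULAR BACKGROUND `A^{(k),ε}` OF (3.29) FOR THE PRINTED REGIONS `Ω = B^k(Λ_k)`, EVERY LEVEL
`1 ≦ k < K_P`, EVERY `Λ_k` A UNION OF BLOCKS, concrete (Higgs)₂,₃ carrier.**  For the torus sub-family (`Shape`, `d`, `L` fixed),
`a, μ₀², m² > 0`: there are `γ > 0`, `c_A > 0` (functions of `d, L, a, μ₀², m², e`) such that for every tower of regions `R`, every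
level `1 ≦ k = j+1 < K_P` with `Λ_k = R.block j` a union of blocks, `L^kε ≦ 1`, at least two `(k+1)`-sites per direction, every
`A : T^{(k)} → ℝ^d` with `|A| ≦ r`, `r·L^kε ≦ c_A`, and EVERY `ψ : Λ_k → ℝ^N`:
`γ(L^kε)^{−2}‖ψ̃‖² ≦ ⟨ψ̃, (a(L^{k+1}ε)^{−2}P(A^{(k),ε}) + Δ^{(k),L^kε}(B^k(Λ_k), A^{(k),ε}))ψ̃⟩` — `ineq233_lower_regular_region` at
the background (3.29), whose (2.23)-regularity `L^kδ = a c′ r` (p35 + p14) turns the three smallness conditions into the threshold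
`c_A`, exactly as in the torus file. [cite: Balaban1982Higgs1, Prop. 2.3 (2.33) p.611; (2.23) p.610; (3.29) p.617]
[cite: Balaban1983RegularityDecay, §5 (5.2)–(5.3) p.593] -/
theorem ineq233_lower_bgVec_region (d L : ℕ) (hd : 1 ≤ d) (hL : Odd L ∧ 1 < L) {a : ℝ} (ha : 0 < a)
    {mu0sq msq : ℝ} (hmu : 0 < mu0sq) (hmsq : 0 < msq) (N : ℕ) (C : ChargeData N) :
    ∃ γ : ℝ, 0 < γ ∧ ∃ cA : ℝ, 0 < cA ∧
      ∀ (P : HiggsLattice.Params) (_S : Shape P), P.d = d → P.L = L →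
      ∀ {K : ℕ} (R : Regions P K), K ≤ P.K → ∀ (j : Fin K), j.val + 1 < P.K →
      (∀ μ, 2 ≤ P.sitesPerDir (j.val + 1 + 1) μ) → P.mesh (j.val + 1) ≤ 1 →
      (∀ y y' : HiggsLattice.Site P (j.val + 1),
        HiggsLattice.blockOf y = HiggsLattice.blockOf y' → (y ∈ R.block j ↔ y' ∈ R.block j)) →
      ∀ {r : ℝ}, r * P.mesh (j.val + 1) ≤ cA →
      ∀ A : HiggsLattice.VecField P (j.val + 1), (∀ x, ‖toSite A x‖ ≤ r) →
        ∀ ψ : LSite R j → V N,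
          γ * ((P.mesh (j.val + 1))⁻¹ ^ 2) * siteInner (extL R j ψ) (extL R j ψ)
            ≤ siteInner (extL R j ψ)
                (precOpA C (pieceF R j) (bgVec mu0sq a (j.val + 1) A) msq a (j.val + 1) (extL R j ψ)) := by
  obtain ⟨c', hc', hder⟩ := covDeriv_propagatorK_sup_bound d L d hd hL ha hmu.le 1
  obtain ⟨γ₀, hγ₀⟩ : ∃ γ₀ : ℝ, γ₀ = min (a * (1 - ((L : ℝ) ^ 2)⁻¹) / (8 * (d : ℝ) + 2 * msq + 4)) (1 / 16) := ⟨_, rfl⟩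
  obtain ⟨c₁, hc₁⟩ : ∃ c₁ : ℝ, c₁ = min a (4 * γ₀) / (L : ℝ) ^ 2 := ⟨_, rfl⟩
  obtain ⟨ρ, hρ⟩ : ∃ ρ : ℝ, ρ = min 1 (min (1 / (16 * ((d : ℝ) ^ 4 * (L : ℝ) ^ d * C.e ^ 2) + 1))
      (min (c₁ / (256 * (γ₀ * (d : ℝ) ^ 3 * C.e ^ 2) + 1)) (1 / (4 * ((d : ℝ) ^ 3 * (L : ℝ) ^ 4 * C.e ^ 2) + 1)))) :=
    ⟨_, rfl⟩
  have hLr : (1 : ℝ) < (L : ℝ) := by exact_mod_cast hL.2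
  have hdr : (1 : ℝ) ≤ (d : ℝ) := by exact_mod_cast hd
  have hγ₀pos : 0 < γ₀ := by
    rw [hγ₀]
    refine lt_min (div_pos (mul_pos ha ?_) (by linarith)) (by norm_num)
    have h1 : (1 : ℝ) < (L : ℝ) ^ 2 := by nlinarith
    have : ((L : ℝ) ^ 2)⁻¹ < 1 := inv_lt_one_of_one_lt₀ h1
    linarith
  have hc₁pos : 0 < c₁ := by rw [hc₁]; exact div_pos (lt_min ha (by linarith)) (by positivity)
  have hX0 : 0 ≤ (d : ℝ) ^ 4 * (L : ℝ) ^ d * C.e ^ 2 := by positivity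
  have hY0 : 0 ≤ γ₀ * (d : ℝ) ^ 3 * C.e ^ 2 := mul_nonneg (mul_nonneg hγ₀pos.le (by positivity)) (sq_nonneg _)
  have hZ0 : 0 ≤ (d : ℝ) ^ 3 * (L : ℝ) ^ 4 * C.e ^ 2 := by positivity
  have hρpos : 0 < ρ := by
    rw [hρ]
    exact lt_min one_pos (lt_min (by positivity) (lt_min (div_pos hc₁pos (by positivity)) (by positivity)))
  refine ⟨c₁ / 2, by linarith, ρ / (a * c' + 1), by positivity, ?_⟩
  intro P S hPd hPL K R hK j hjK hN2 hs hU r hr A hA ψ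
  subst hPd hPL
  have hk1 : 1 ≤ j.val + 1 := Nat.le_add_left 1 _
  have hLnat : 1 < P.L := hL.2
  have hmesh : 0 < P.mesh (j.val + 1) := P.mesh_pos _
  have hmesh0 : 0 < P.mesh 0 := P.mesh_pos 0
  have hmeshK : P.mesh (j.val + 1) = (P.L : ℝ) ^ (j.val + 1) * P.mesh 0 := by
    unfold HiggsLattice.Params.mesh; ring
  have hr0 : 0 ≤ r := (norm_nonneg _).trans (hA fun _ => 0)
  -- the regularity of the background: `|Ã(b + εe_ν) − Ã(b)| ≤ δ`, `δ = ε·a c′ r (Lᵏε)^{-1}`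
  obtain ⟨δ, hδdef⟩ : ∃ δ : ℝ, δ = P.mesh 0 * (a * c' * (P.mesh (j.val + 1))⁻¹ * r) := ⟨_, rfl⟩
  have hδ : 0 ≤ δ := by
    rw [hδdef]
    exact mul_nonneg hmesh0.le (mul_nonneg (mul_nonneg (mul_nonneg ha.le hc'.le) (inv_nonneg.mpr hmesh.le)) hr0)
  have hreg : ∀ (z : HiggsLattice.Site P 0) (μ' ν : Fin P.d),
      |bgVec mu0sq a (j.val + 1) A ⟨z.shift ν, μ'⟩ - bgVec mu0sq a (j.val + 1) A ⟨z, μ'⟩| ≤ δ := fun z μ' ν => by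
    rw [hδdef]
    exact abs_bgVec_shift_sub_le hk1 hLr ha
      (fun φ M' hφ b => hder P S rfl rfl (zeroCharge P.d) hk1 hjK.le hs φ M' hφ b) A hA z μ' ν
  -- the smallness parameter `t = a c′·(r·Lᵏε) ≤ ρ ≤ 1`
  obtain ⟨t, htdef⟩ : ∃ t : ℝ, t = a * c' * r * P.mesh (j.val + 1) := ⟨_, rfl⟩
  have ht0 : 0 ≤ t := by rw [htdef]; exact mul_nonneg (mul_nonneg (mul_nonneg ha.le hc'.le) hr0) hmesh.le
  have htρ : t ≤ ρ := by
    have hac : 0 ≤ a * c' := mul_nonneg ha.le hc'.le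
    calc t = a * c' * (r * P.mesh (j.val + 1)) := by rw [htdef]; ring
      _ ≤ a * c' * (ρ / (a * c' + 1)) := mul_le_mul_of_nonneg_left hr hac
      _ = ρ * (a * c' / (a * c' + 1)) := by ring
      _ ≤ ρ * 1 := mul_le_mul_of_nonneg_left ((div_le_one (by linarith)).mpr (by linarith)) hρpos.le
      _ = ρ := mul_one ρ
  have ht1 : t ≤ 1 := htρ.trans (by rw [hρ]; exact min_le_left _ _)
  have hkey1 : (P.L : ℝ) ^ (j.val + 1) * δ * P.mesh (j.val + 1) = t := by
    have hmi : (P.mesh (j.val + 1))⁻¹ * P.mesh (j.val + 1) = 1 := inv_mul_cancel₀ hmesh.ne'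
    calc (P.L : ℝ) ^ (j.val + 1) * δ * P.mesh (j.val + 1)
        = ((P.L : ℝ) ^ (j.val + 1) * P.mesh 0) * (a * c' * r) * ((P.mesh (j.val + 1))⁻¹ * P.mesh (j.val + 1)) := by
          rw [hδdef]; ring
      _ = t := by rw [hmi, ← hmeshK, htdef]; ring
  have hkey2 : ((P.L : ℝ) ^ (j.val + 1)) ^ 2 * P.mesh 0 * δ = t := by
    rw [← hkey1, hmeshK]; ring
  -- the constant `γ₀` of (II.3.29) at a regular field
  obtain ⟨-, hγB, hγ16⟩ := gamma0_regular_spec (P := P) ha hLnat hmsq.le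
  rw [← hγ₀] at hγB hγ16
  -- the three smallness conditions from `t ≤ ρ`
  have hsmall : 8 * (P.d : ℝ) ^ 4 * (P.L : ℝ) ^ P.d * C.e ^ 2 * P.mesh (j.val + 1) ^ 2 *
      ((P.L : ℝ) ^ (j.val + 1)) ^ 2 * δ ^ 2 ≤ 1 / 2 := by
    have e : 8 * (P.d : ℝ) ^ 4 * (P.L : ℝ) ^ P.d * C.e ^ 2 * P.mesh (j.val + 1) ^ 2 * ((P.L : ℝ) ^ (j.val + 1)) ^ 2 * δ ^ 2
        = 1 / 2 * (16 * ((P.d : ℝ) ^ 4 * (P.L : ℝ) ^ P.d * C.e ^ 2) *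
            ((P.L : ℝ) ^ (j.val + 1) * δ * P.mesh (j.val + 1)) ^ 2) := by ring
    rw [e, hkey1]
    have htX : t ≤ 1 / (16 * ((P.d : ℝ) ^ 4 * (P.L : ℝ) ^ P.d * C.e ^ 2) + 1) :=
      htρ.trans (by rw [hρ]; exact (min_le_right _ _).trans (min_le_left _ _))
    linarith [mul_sq_le_of_le_div hX0 ht0 ht1 (by norm_num) htX]
  have hE : 64 * γ₀ * (P.d : ℝ) ^ 3 * C.e ^ 2 * ((P.L : ℝ) ^ (j.val + 1)) ^ 2 * δ ^ 2 * P.mesh (j.val + 1) ^ 2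
      ≤ min a (4 * γ₀) / (P.L : ℝ) ^ 2 / 4 := by
    have e : 64 * γ₀ * (P.d : ℝ) ^ 3 * C.e ^ 2 * ((P.L : ℝ) ^ (j.val + 1)) ^ 2 * δ ^ 2 * P.mesh (j.val + 1) ^ 2
        = 1 / 4 * (256 * (γ₀ * (P.d : ℝ) ^ 3 * C.e ^ 2) * ((P.L : ℝ) ^ (j.val + 1) * δ * P.mesh (j.val + 1)) ^ 2) := by
      ring
    rw [e, hkey1, ← hc₁]
    have htY : t ≤ c₁ / (256 * (γ₀ * (P.d : ℝ) ^ 3 * C.e ^ 2) + 1) :=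
      htρ.trans (by rw [hρ]; exact (min_le_right _ _).trans ((min_le_right _ _).trans (min_le_left _ _)))
    linarith [mul_sq_le_of_le_div hY0 ht0 ht1 (by norm_num) htY]
  have hθ : (P.L : ℝ) ^ 2 * P.d *
      (2 * P.d * P.L * ((P.L : ℝ) ^ (j.val + 1)) ^ 2 * (P.mesh 0 * |C.e|) * δ) ^ 2 ≤ 1 := by
    have e : (P.L : ℝ) ^ 2 * P.d * (2 * P.d * P.L * ((P.L : ℝ) ^ (j.val + 1)) ^ 2 * (P.mesh 0 * |C.e|) * δ) ^ 2
        = 4 * ((P.d : ℝ) ^ 3 * (P.L : ℝ) ^ 4 * C.e ^ 2) * (((P.L : ℝ) ^ (j.val + 1)) ^ 2 * P.mesh 0 * δ) ^ 2 := by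
      rw [← sq_abs C.e]; ring
    rw [e, hkey2]
    have htZ : t ≤ 1 / (4 * ((P.d : ℝ) ^ 3 * (P.L : ℝ) ^ 4 * C.e ^ 2) + 1) :=
      htρ.trans (by rw [hρ]; exact (min_le_right _ _).trans ((min_le_right _ _).trans (min_le_right _ _)))
    exact mul_sq_le_of_le_div hZ0 ht0 ht1 (by norm_num) htZ
  have hmain := ineq233_lower_regular_region R C ha hLnat hmsq hK j hjK hN2 hs hU (bgVec mu0sq a (j.val + 1) A) hδ hreg
    hsmall hγ₀pos.le hγB hγ16 hE hθ ψ
  rw [← hc₁] at hmain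
  exact hmain

end Background


/-! ## §4 (v1.1) Level `k = 0` for a union of blocks `Ω ⊂ T_ε` at a regular `A` -/

section LevelZeroRegion

open B2Eq255Concrete (barA_zero_level)

variable (C : ChargeData N) (Ω : Finset (HiggsLattice.Site P 0)) {a msq : ℝ}

/-- (2.17) at a general `A` for a region `Ω`: `⟨ψ, Δ^{(0),ε}(Ω, A)ψ⟩ = Σ_{b⊂Ω}ε^d|(D_Aψ)(b)|² + m²‖ψ‖²` for EVERY field `ψ` on
`T_ε` (the Neumann form keeps the bonds inside `Ω`; the typer's `siteInner_covLaplacianN`). [cite: Balaban1982Higgs1, (2.17) p.610] -/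
theorem siteInner_deltaKA_zero_region_cov (A : HiggsLattice.VecField P 0) (msq a : ℝ) (ψ : ScalarField P 0 N) :
    siteInner ψ (deltaKA C Ω A msq a 0 ψ)
      = (∑ b : HiggsLattice.PBond P 0, (if Inside Ω b then P.mesh 0 ^ P.d * ‖covDeriv C A ψ b‖ ^ 2 else 0))
        + msq * siteInner ψ ψ := by
  simp only [deltaKA_zero, delta0, LinearMap.add_apply, LinearMap.smul_apply, LinearMap.id_apply,
    siteInner_add_right, siteInner_smul_right]
  rw [siteInner_covLaplacianN C Ω A ψ ψ]
  congr 1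
  refine Finset.sum_congr rfl fun b _ => ?_
  split_ifs
  · rw [real_inner_self_eq_norm_sq]
  · rfl

/-- **(2.33), LOWER HALF, LEVEL `0`, AT A REGULAR `A ≠ 0`, FOR A UNION OF BLOCKS `Ω ⊂ T_ε`** (`a, m² ≥ 0`, `0 < K`, at least two
level-`1` sites per direction, `A` `δ`-regular on `T_ε` with `L²dθ₀² ≤ 1`, `θ₀ = 2dL·ε|e|δ`): for every `ψ` vanishing off `Ω`,
`(3c₁⁰/4)ε^{−2}‖ψ‖² ≤ ⟨ψ, (a(Lε)^{−2}P(A) + Δ^{(0),ε}(Ω, A))ψ⟩`, `c₁⁰ = min{a, 4}/L²` — §1's support-respecting covariant block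
Poincaré inequality at `k = 0` (`Ā^{(0)} = A`) + the identity `siteInner_deltaKA_zero_region_cov` (mass term dropped); no
`(L^kδ)²`-error, no `ε ≤ 1`. [cite: Balaban1982Higgs1, Prop. 2.3 (2.33) p.611; (2.17) p.610]
[cite: Balaban1983RegularityDecay, §5 (5.2)–(5.3) p.593] -/
theorem ineq233_lower_regular_region_levelZero (ha : 0 ≤ a) (hmsq : 0 ≤ msq) (hK : 0 < P.K)
    (hN2 : ∀ μ, 2 ≤ P.sitesPerDir 1 μ)
    (hU : ∀ x x' : HiggsLattice.Site P 0, HiggsLattice.blockOf x = HiggsLattice.blockOf x' → (x ∈ Ω ↔ x' ∈ Ω))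
    (A : HiggsLattice.VecField P 0) {δ : ℝ} (hδ : 0 ≤ δ)
    (hreg : ∀ (z : HiggsLattice.Site P 0) (μ' ν : Fin P.d), |A ⟨z.shift ν, μ'⟩ - A ⟨z, μ'⟩| ≤ δ)
    (hθ : (P.L : ℝ) ^ 2 * P.d * (2 * P.d * P.L * (P.mesh 0 * |C.e|) * δ) ^ 2 ≤ 1)
    (ψ : ScalarField P 0 N) (hψ : ∀ x, x ∉ Ω → ψ x = 0) :
    3 * (min a 4 / (P.L : ℝ) ^ 2) / 4 * ((P.mesh 0)⁻¹ ^ 2) * siteInner ψ ψ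
      ≤ siteInner ψ (precOpA C Ω A msq a 0 ψ) := by
  have hL1 : (1 : ℝ) ≤ (P.L : ℝ) := by exact_mod_cast P.hL
  have hL0 : (0 : ℝ) < (P.L : ℝ) := by linarith
  have hm : 0 < P.mesh 0 := P.mesh_pos 0
  obtain ⟨S, hS⟩ : ∃ S, S = siteInner ψ ψ := ⟨_, rfl⟩
  obtain ⟨X, hX⟩ : ∃ X, X = siteInner ψ (blockProjA C A 0 ψ) := ⟨_, rfl⟩
  obtain ⟨B, hB⟩ : ∃ B, B = ∑ b : HiggsLattice.PBond P 0,
      (if Inside Ω b then P.mesh 0 ^ P.d * ‖covDeriv C A ψ b‖ ^ 2 else 0) := ⟨_, rfl⟩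
  obtain ⟨D, hD⟩ : ∃ D, D = siteInner ψ (deltaKA C Ω A msq a 0 ψ) := ⟨_, rfl⟩
  obtain ⟨θ, hθdef⟩ : ∃ θ : ℝ, θ = 2 * P.d * P.L * (P.mesh 0 * |C.e|) * δ := ⟨_, rfl⟩
  obtain ⟨c₁, hc₁⟩ : ∃ c₁ : ℝ, c₁ = min a 4 / (P.L : ℝ) ^ 2 := ⟨_, rfl⟩
  rw [← hθdef] at hθ
  have hS0 : 0 ≤ S := hS ▸ siteInner_self_nonneg ψ
  have hX0 : 0 ≤ X := by rw [hX, siteInner_blockProjA_eq]; exact siteInner_self_nonneg _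
  have hB0 : 0 ≤ B := by
    rw [hB]
    exact Finset.sum_nonneg fun c _ => by split_ifs <;> positivity
  have hmi0 : 0 < (P.mesh 0)⁻¹ ^ 2 := by positivity
  -- §1 at level 0, `Ā^{(0)} = A`, `(L^0)^2 = 1`
  have hCP : S ≤ X + (P.L : ℝ) ^ 2 / 4 * P.mesh 0 ^ 2 * B + (P.L : ℝ) ^ 2 / 4 * P.d * θ ^ 2 * S := by
    have h := siteInner_self_le_blockProjA_add_cov_inside C hK hN2 Ω hU A hδ hreg ψ hψ
    rw [barA_zero_level, pow_zero, one_pow, mul_one] at h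
    rw [hS, hX, hB, hθdef]; exact h
  -- (2.17) for the region
  have hΔ : B + msq * S = D := by rw [hB, hS, hD, siteInner_deltaKA_zero_region_cov]
  have hprec : siteInner ψ (precOpA C Ω A msq a 0 ψ) = a * ((P.mesh (0 + 1))⁻¹ ^ 2) * X + D := by
    rw [precOpA, LinearMap.add_apply, LinearMap.smul_apply, siteInner_add_right, siteInner_smul_right, hX, hD]
  have hinv : ((P.L : ℝ) * P.mesh 0)⁻¹ ^ 2 = ((P.L : ℝ) ^ 2)⁻¹ * (P.mesh 0)⁻¹ ^ 2 := by
    rw [mul_inv, mul_pow, inv_pow]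
  rw [hprec, ← hS, ← hc₁, mesh_succ 0, hinv]
  -- the constants
  have hc₁0 : 0 ≤ c₁ := by rw [hc₁]; exact div_nonneg (le_min ha (by norm_num)) (by positivity)
  have hc₁a : c₁ ≤ a * ((P.L : ℝ) ^ 2)⁻¹ := by
    rw [hc₁, div_eq_mul_inv]
    exact mul_le_mul_of_nonneg_right (min_le_left _ _) (inv_nonneg.mpr (by positivity))
  have hc₁γ : c₁ * ((P.L : ℝ) ^ 2 / 4) ≤ 1 := by
    have hL2 : (0 : ℝ) < (P.L : ℝ) ^ 2 := by positivity
    have e : min a 4 / (P.L : ℝ) ^ 2 * ((P.L : ℝ) ^ 2 / 4) = min a 4 / 4 := by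
      rw [div_mul_div_comm, mul_comm (min a 4), mul_div_mul_left _ _ hL2.ne']
    rw [hc₁, e]
    linarith [min_le_right a 4]
  -- the pieces, multiplied out
  have hmm : (P.mesh 0)⁻¹ ^ 2 * P.mesh 0 ^ 2 = 1 := by field_simp
  have F1 : c₁ * (P.mesh 0)⁻¹ ^ 2 * S ≤ c₁ * (P.mesh 0)⁻¹ ^ 2 * X + c₁ * ((P.L : ℝ) ^ 2 / 4) * B
      + c₁ * (P.mesh 0)⁻¹ ^ 2 * ((P.L : ℝ) ^ 2 / 4 * P.d * θ ^ 2 * S) := by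
    have h := mul_le_mul_of_nonneg_left hCP (mul_nonneg hc₁0 hmi0.le)
    have e : c₁ * (P.mesh 0)⁻¹ ^ 2 * (X + (P.L : ℝ) ^ 2 / 4 * P.mesh 0 ^ 2 * B + (P.L : ℝ) ^ 2 / 4 * P.d * θ ^ 2 * S)
        = c₁ * (P.mesh 0)⁻¹ ^ 2 * X + c₁ * ((P.L : ℝ) ^ 2 / 4) * ((P.mesh 0)⁻¹ ^ 2 * P.mesh 0 ^ 2) * B
          + c₁ * (P.mesh 0)⁻¹ ^ 2 * ((P.L : ℝ) ^ 2 / 4 * P.d * θ ^ 2 * S) := by ring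
    rw [hmm, mul_one] at e
    linarith
  have F2 : c₁ * ((P.mesh 0)⁻¹ ^ 2 * X) ≤ a * ((P.L : ℝ) ^ 2)⁻¹ * ((P.mesh 0)⁻¹ ^ 2 * X) :=
    mul_le_mul_of_nonneg_right hc₁a (mul_nonneg hmi0.le hX0)
  have F3 : c₁ * ((P.L : ℝ) ^ 2 / 4) * B ≤ 1 * B := mul_le_mul_of_nonneg_right hc₁γ hB0
  have F5 : 0 ≤ msq * S := mul_nonneg hmsq hS0
  have F6 : c₁ * (P.mesh 0)⁻¹ ^ 2 * ((P.L : ℝ) ^ 2 / 4 * P.d * θ ^ 2 * S) ≤ c₁ * (P.mesh 0)⁻¹ ^ 2 * (1 / 4 * S) := by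
    have h2 : (P.L : ℝ) ^ 2 / 4 * P.d * θ ^ 2 ≤ 1 / 4 := by linarith
    exact mul_le_mul_of_nonneg_left (mul_le_mul_of_nonneg_right h2 hS0) (mul_nonneg hc₁0 hmi0.le)
  linarith

end LevelZeroRegion

end Literature.MathematicalPhysics.QuantumFieldTheory.Balaban1983to89.B1Ineq233LowerBackgroundRegion

end
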